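import Mathlib
import HarnessLib
import Summits.HodgeConjecture.HodgeConjecture.Theorems.HeckePrymWeilSemiregularSpreadOfBlochLifts
import Summits.HodgeConjecture.HodgeConjecture.Theorems.EightfoldBlochSeedsBlochSpreadEightFourSupportAlongChart
import Summits.HodgeConjecture.HodgeConjecture.Theorems.EightfoldBlochSeedsBlochSpreadEightFourSupportedClass
import Literature.AlgebraicGeometry.HodgeTheory.BlochSemiregularSpread
import Literature.AlgebraicGeometry.HodgeTheory.BlochSemiregularityTheorem
import Literature.AlgebraicGeometry.HodgeTheory.BlochSemiregularCompIso
import Literature.AlgebraicGeometry.HodgeTheory.IsoTransport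
import Literature.AlgebraicGeometry.HodgeTheory.ClassesSupportedOn

/-!
# Crux `BlochSpreadEightFour` (stmt-HodgeConjecture-18884), line `bloch-lifts-fulton`: the WEAKEST pivot
# `(LC′)` — LIFTING a class supported on the integral central fibre of a flat family to a relative class —
# and the SPREAD glue WITHOUT purity and WITHOUT any non-vanishing input

HONEST FRAMING: helper file (route-independent: no `Theses` import); no stub is closed; nothing here proves
`BlochSpreadEightFour`, H2, HC_AV or HC. Third pivot file of this hand (after `(SC♭)` p823598 and `(RC♭)`
p823691).

OBSERVATION (this hand). In the SPREAD glue the line already OWNS a non-zero class supported on the central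
fibre of Bloch's lift: `θ^*(W|_{X₀})` itself (the case `W|_{X₀} = 0` being settled by rigidity). So the
Fulton-side input need not PRODUCE a non-zero class (Fulton 19.1.1 / Wirtinger: `cl(Z₀) ≠ 0`, the tree's
unproved `map_fundamentalClass_ne_zero_of_height_eq`) nor be compared with `W` through purity: it suffices
that the GIVEN class lifts —

  `(LC′)`: for `g : 𝒳 ⟶ V` a smooth projective family of relative dimension `n` over a smooth `V`, `0 < p`,
  `ι : 𝒲 ↪ 𝒳` closed with `𝒲` flat over `V`, `v₀ ∈ V(ℂ)` with `𝒲_{v₀} := 𝒲 ×_𝒳 𝒳_{v₀}` INTEGRAL, all of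
  its points of codimension `≥ p` in `𝒳_{v₀}` and one of codimension exactly `p`: EVERY class
  `y ∈ H²ᵖ(𝒳_{v₀}(ℂ); ℂ)` supported on the image of `𝒲_{v₀}` is the restriction `Γ|_{𝒳_{v₀}} = y` of a
  class `Γ ∈ H²ᵖ(𝒳(ℂ); ℂ)` whose fibre restrictions are algebraic over a Zariski-open `U₁ ∋ v₀.pt`;

classically: `H²ᵖ(𝒳, 𝒳 ∖ 𝒲) → H²ᵖ(X₀, X₀ ∖ 𝒲_{v₀})` is onto, because at a smooth point of the integral
central fibre the flat `𝒲 → V` is smooth, `𝒲(ℂ)` is a submanifold transversal to `X₀(ℂ)`, and a Thom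
class restricts to a Thom class (Fulton 1998 §19.2 Cor. 19.2 (b) with excess `0`; both sides are lines by
purity, Lemma 19.1.1) — a statement of pure topology of the pair `(𝒳(ℂ), 𝒲(ℂ))`, with NO degree /
Wirtinger / resolution input. What is proved (sorry-free, standard axioms):

* `liftedClassNear_of_relativeClassNearOfIntegralFibre` — `(RC♭) ⟹ (LC′)` (purity on the irreducible
  image, `exists_ker_restrictCompl_le_span_of_isIrreducible`, PROVED in the tree: `y = μ • Γ|_{X₀}`); with
  the landed `relativeClassNearOfIntegralFibre_of_fulton` / `…_of_supportedClassOfIntegralFibre` the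
  REGISTERED Fulton fact and `(SC♭)` imply `(LC′)` — reshaping the stub to `(LC′)` is CONSERVATIVE.
* `liftedClassNear_of_liftedSupportedClass` — the supported form `(LC)` (lift to a class SUPPORTED on
  `ι(𝒲)` with prescribed central restriction) implies `(LC′)` ((F3)+(F4)+(F4′)).
* `semiregularSpread_of_blochLifts_of_liftedClassNear` — the SPREAD glue with inputs
  `Bloch1972_semiregularSubschemeLifts` and `(LC′)`: lift `y := θ^*(W|_{X₀})`, then `pr^* W − Γ` dies on
  `X₀'`, hence (rigidity) on the fibres over a Zariski neighbourhood, where `pr^* W|_{X_{t'}} = Γ|_{X_{t'}}`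
  is algebraic; descend along the open `π`. No purity, no `λ`, no non-vanishing.

References: [Bloch1972Semiregularity] Thm. (7.1), (7.4), Rem. (7.5); [BuchweitzFlenner2003] §5;
[Fulton1998] §10.1 Prop. 10.1 (a), §19.1 eq. (1), Lemma 19.1.1, §19.2 Cor. 19.2 (b);
[VoisinHodgeII2003] §3.1.2, §9.2; [Hartshorne1977] III Prop. 9.5, Thm. 10.2.
-/

-- every declaration of this problem lives in `Summit.HodgeConjecture.HodgeConjecture.…` (summit = sub-problem)
set_option linter.dupNamespace false

noncomputable section

open CategoryTheory CategoryTheory.Limits AlgebraicGeometry MonoidalCategory Order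
open Literature.AlgebraicGeometry.Motives Literature.AlgebraicGeometry.HodgeTheory
open Literature.AlgebraicGeometry.Deformation
open Literature.AlgebraicTopology.SingularHomology

namespace Summit.HodgeConjecture.HodgeConjecture.Theorems

/-- **`(RC♭) ⟹ (LC′)`**: a relative class `Γ` with non-zero central restriction supported on the
(irreducible, closed) image `W₀` of the integral central fibre lifts every `y` supported on `W₀` up to a
scalar — the classes supported on `W₀` form a line (purity, `exists_ker_restrictCompl_le_span_of_isIrreducible`),
so `y = μ • Γ|_{X₀} = (μ • Γ)|_{X₀}`, and `μ • Γ` has algebraic fibre restrictions wherever `Γ` has.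
[cite: Fulton1998, §19.1 Lemma 19.1.1 and eq. (3)] -/
theorem liftedClassNear_of_relativeClassNearOfIntegralFibre
    (hRC : ∀ ⦃n p : ℕ⦄ ⦃𝒳 V : SchemeOver ℂ⦄ (g : 𝒳 ⟶ V), 0 < p → IsSmoothProjectiveFamily g n →
      AlgebraicGeometry.Smooth V.hom →
      ∀ (𝒲 : Scheme) (ι : 𝒲 ⟶ 𝒳.left), IsClosedImmersion ι → Flat (ι ≫ g.left) →
      ∀ (v₀ : ComplexPoints V), AlgebraicGeometry.IsIntegral (pullback ι (fiberι g v₀).left) →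
      (∀ z : ↥(pullback ι (fiberι g v₀).left),
        (p : ℕ∞) ≤ Order.coheight ((pullback.snd ι (fiberι g v₀).left).base z)) →
      (∃ z : ↥(pullback ι (fiberι g v₀).left),
        Order.coheight ((pullback.snd ι (fiberι g v₀).left).base z) = (p : ℕ∞)) →
      ∃ (Γ : complexBetti 𝒳 (2 * p)) (U₁ : Set V.left), IsOpen U₁ ∧ v₀.pt ∈ U₁ ∧
        (∀ t : ComplexPoints V, t.pt ∈ U₁ →
          complexBetti.map (fiberι g t) (2 * p) Γ ∈ algebraicClasses (fiberOver g t) p) ∧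
        complexBetti.map (fiberι g v₀) (2 * p) Γ ∈ classesSupportedOn (fiberOver g v₀)
          (Set.range (pullback.snd ι (fiberι g v₀).left).base) (2 * p) ∧
        complexBetti.map (fiberι g v₀) (2 * p) Γ ≠ 0) :
    ∀ ⦃n p : ℕ⦄ ⦃𝒳 V : SchemeOver ℂ⦄ (g : 𝒳 ⟶ V), 0 < p → IsSmoothProjectiveFamily g n →
      AlgebraicGeometry.Smooth V.hom →
      ∀ (𝒲 : Scheme) (ι : 𝒲 ⟶ 𝒳.left), IsClosedImmersion ι → Flat (ι ≫ g.left) →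
      ∀ (v₀ : ComplexPoints V), AlgebraicGeometry.IsIntegral (pullback ι (fiberι g v₀).left) →
      (∀ z : ↥(pullback ι (fiberι g v₀).left),
        (p : ℕ∞) ≤ Order.coheight ((pullback.snd ι (fiberι g v₀).left).base z)) →
      (∃ z : ↥(pullback ι (fiberι g v₀).left),
        Order.coheight ((pullback.snd ι (fiberι g v₀).left).base z) = (p : ℕ∞)) →
      ∀ y ∈ classesSupportedOn (fiberOver g v₀) (Set.range (pullback.snd ι (fiberι g v₀).left).base) (2 * p),
      ∃ (Γ : complexBetti 𝒳 (2 * p)) (U₁ : Set V.left), IsOpen U₁ ∧ v₀.pt ∈ U₁ ∧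
        (∀ t : ComplexPoints V, t.pt ∈ U₁ →
          complexBetti.map (fiberι g t) (2 * p) Γ ∈ algebraicClasses (fiberOver g t) p) ∧
        complexBetti.map (fiberι g v₀) (2 * p) Γ = y := by
  intro n p 𝒳 V g hp hg hV 𝒲 ι hι hflat v₀ hint hcodim hz y hy
  obtain ⟨Γ, U₁, hU₁, hv₀, halg, hsupp, h0⟩ := hRC g hp hg hV 𝒲 ι hι hflat v₀ hint hcodim hz
  haveI := hι
  haveI := hint
  set j := pullback.snd ι (fiberι g v₀).left
  haveI : IsClosedImmersion j := inferInstance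
  have hW₀c : IsClosed (Set.range j.base) := j.isClosedEmbedding.isClosed_range
  have hW₀i : IsIrreducible (Set.range j.base) := by
    rw [← Set.image_univ]
    exact (IrreducibleSpace.isIrreducible_univ _).image _ j.continuous.continuousOn
  have hcoh : ∀ z ∈ Set.range j.base, (p : ℕ∞) ≤ Order.coheight z := by
    rintro z ⟨w, rfl⟩
    exact hcodim w
  -- purity: both `y` and `Γ|_{X₀}` lie on the line `ℂ • τ`
  obtain ⟨τ, hτ⟩ := exists_ker_restrictCompl_le_span_of_isIrreducible (hg.isSmoothProjective v₀)
    hW₀c hW₀i (c := p) hp hcoh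
  obtain ⟨a, ha⟩ := Submodule.mem_span_singleton.1 (hτ hsupp)
  obtain ⟨b, hb⟩ := Submodule.mem_span_singleton.1 (hτ hy)
  have ha0 : a ≠ 0 := by
    rintro rfl
    exact h0 (by rw [← ha, zero_smul])
  refine ⟨(b / a) • Γ, U₁, hU₁, hv₀, fun t ht => by rw [map_smul]; exact Submodule.smul_mem _ _ (halg t ht), ?_⟩
  rw [map_smul, ← ha, ← hb, smul_smul, div_mul_cancel₀ b ha0]

/-- **`(LC) ⟹ (LC′)`**: a lift to a class SUPPORTED on `ι(𝒲)` has algebraic fibre restrictions over the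
Zariski-open neighbourhood of `v₀` produced by
`exists_isOpen_forall_map_fiberι_mem_algebraicClasses_of_flat_family` ((F3)+(F4)+(F4′): the flat family
has fibres of codimension `≥ p` near the central one, and classes supported in codimension `≥ p` are
algebraic). [cite: Fulton1998, §19.1 eq. (1); §10.1 Prop. 10.1 (a)] [cite: Hartshorne1977, III Prop. 9.5] -/
theorem liftedClassNear_of_liftedSupportedClass
    (hLC : ∀ ⦃n p : ℕ⦄ ⦃𝒳 V : SchemeOver ℂ⦄ (g : 𝒳 ⟶ V), 0 < p → IsSmoothProjectiveFamily g n →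
      AlgebraicGeometry.Smooth V.hom →
      ∀ (𝒲 : Scheme) (ι : 𝒲 ⟶ 𝒳.left), IsClosedImmersion ι → Flat (ι ≫ g.left) →
      ∀ (v₀ : ComplexPoints V), AlgebraicGeometry.IsIntegral (pullback ι (fiberι g v₀).left) →
      (∀ z : ↥(pullback ι (fiberι g v₀).left),
        (p : ℕ∞) ≤ Order.coheight ((pullback.snd ι (fiberι g v₀).left).base z)) →
      (∃ z : ↥(pullback ι (fiberι g v₀).left),
        Order.coheight ((pullback.snd ι (fiberι g v₀).left).base z) = (p : ℕ∞)) →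
      ∀ y ∈ classesSupportedOn (fiberOver g v₀) (Set.range (pullback.snd ι (fiberι g v₀).left).base) (2 * p),
      ∃ Γ : complexBetti 𝒳 (2 * p),
        Γ ∈ classesSupportedOn 𝒳 (Set.range ι.base) (2 * p) ∧
        complexBetti.map (fiberι g v₀) (2 * p) Γ = y) :
    ∀ ⦃n p : ℕ⦄ ⦃𝒳 V : SchemeOver ℂ⦄ (g : 𝒳 ⟶ V), 0 < p → IsSmoothProjectiveFamily g n →
      AlgebraicGeometry.Smooth V.hom →
      ∀ (𝒲 : Scheme) (ι : 𝒲 ⟶ 𝒳.left), IsClosedImmersion ι → Flat (ι ≫ g.left) →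
      ∀ (v₀ : ComplexPoints V), AlgebraicGeometry.IsIntegral (pullback ι (fiberι g v₀).left) →
      (∀ z : ↥(pullback ι (fiberι g v₀).left),
        (p : ℕ∞) ≤ Order.coheight ((pullback.snd ι (fiberι g v₀).left).base z)) →
      (∃ z : ↥(pullback ι (fiberι g v₀).left),
        Order.coheight ((pullback.snd ι (fiberι g v₀).left).base z) = (p : ℕ∞)) →
      ∀ y ∈ classesSupportedOn (fiberOver g v₀) (Set.range (pullback.snd ι (fiberι g v₀).left).base) (2 * p),
      ∃ (Γ : complexBetti 𝒳 (2 * p)) (U₁ : Set V.left), IsOpen U₁ ∧ v₀.pt ∈ U₁ ∧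
        (∀ t : ComplexPoints V, t.pt ∈ U₁ →
          complexBetti.map (fiberι g t) (2 * p) Γ ∈ algebraicClasses (fiberOver g t) p) ∧
        complexBetti.map (fiberι g v₀) (2 * p) Γ = y := by
  intro n p 𝒳 V g hp hg hV 𝒲 ι hι hflat v₀ hint hcodim hz y hy
  obtain ⟨Γ, hΓsupp, hΓy⟩ := hLC g hp hg hV 𝒲 ι hι hflat v₀ hint hcodim hz y hy
  haveI := hι
  haveI := hflat
  haveI := hV
  haveI := hg.smooth
  haveI : UniversallyClosed g.left := by haveI := hg.isProper; infer_instance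
  haveI : IsLocallyNoetherian V.left := LocallyOfFiniteType.isLocallyNoetherian V.hom
  haveI : IsLocallyNoetherian 𝒳.left := LocallyOfFiniteType.isLocallyNoetherian g.left
  haveI : IsLocallyNoetherian 𝒲 := LocallyOfFiniteType.isLocallyNoetherian ι
  have hXreg : ∀ x : 𝒳.left, g.left.base x = v₀.pt → IsRegularLocalRing (𝒳.left.presheaf.stalk x) :=
    fun x _ => isRegularLocalRing_stalk_of_isSmoothProjectiveFamily hg x
  have hWeq : Set.range (pullback.snd ι (fiberι g v₀).left).base =
      (fiberι g v₀).left.base ⁻¹' Set.range ι.base :=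
    Scheme.Pullback.range_snd _ _
  have hcodim' : ∀ z : (fiberOver g v₀).left,
      (fiberι g v₀).left.base z ∈ Set.range ι.base → (p : ℕ∞) ≤ Order.coheight z := by
    intro z hz'
    have hz'' : z ∈ Set.range (pullback.snd ι (fiberι g v₀).left).base := by rw [hWeq]; exact hz'
    obtain ⟨w, rfl⟩ := hz''
    exact hcodim w
  obtain ⟨U₁, hU₁, hv₀, halg⟩ :=
    exists_isOpen_forall_map_fiberι_mem_algebraicClasses_of_flat_family g ι v₀ hXreg hcodim' hΓsupp
  exact ⟨Γ, U₁, hU₁, hv₀, halg, hΓy⟩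

/-- **Glue with the weakest pivot `(LC′)` — no purity, no non-vanishing input.** Granted
`Bloch1972_semiregularSubschemeLifts` and `(LC′)`: for a smooth projective family `f : 𝒳 ⟶ S` of relative
dimension `n`, projective in Hartshorne's sense, over a smooth `ℂ`-scheme `S`, a complex point `s₀`, an
integral closed subscheme `i₀ : Z₀ ↪ X₀ = 𝒳_{s₀}` which is a local complete intersection of codimension
exactly `p` and Bloch-semiregular, and a global class `W ∈ H²ᵖ(𝒳(ℂ); ℂ)` of fibrewise Hodge type `(p,p)`
whose restriction to `X₀` is supported on `Z₀`, the restriction `W|_{𝒳_t}` is algebraic for every `t` in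
an open neighbourhood of `s₀` in `S(ℂ)`. Proof: rigidity if `W|_{X₀} = 0`; otherwise Bloch's flat lift
`𝒵 ⊆ 𝒳 ×_S V` over a smooth `π : V ⟶ S` has integral scheme-theoretic central fibre (`e : 𝒵_{v₀} ≅ Z₀`)
with image `θ⁻¹(Z₀)`, on which `y := θ^*(W|_{X₀})` is supported; `(LC′)` lifts `y` to `Γ` with algebraic
fibre restrictions over `U₁ ∋ v₀`; `pr^* W − Γ` vanishes on `X₀'`, hence on the fibres over a Zariski
neighbourhood `U` (rigidity), so `pr^* W|_{X_{t'}} = Γ|_{X_{t'}}` is algebraic for `t'.pt ∈ U ∩ U₁`;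
descend along the open map `π` with lifting of complex points.
[cite: Bloch1972Semiregularity, Thm. (7.1), proof of Thm. (7.4) (pp. 64–65), Remark (7.5)]
[cite: BuchweitzFlenner2003, §5, end of the proof of Thm. 5.1 / Thm. 5.2]
[cite: Fulton1998, §10.1 Prop. 10.1 (a); §19.1 eq. (1) and Lemma 19.1.1] [cite: VoisinHodgeII2003, §3.1.2] -/
theorem semiregularSpread_of_blochLifts_of_liftedClassNear
    (hB : Bloch1972_semiregularSubschemeLifts)
    (hLC : ∀ ⦃n p : ℕ⦄ ⦃𝒳 V : SchemeOver ℂ⦄ (g : 𝒳 ⟶ V), 0 < p → IsSmoothProjectiveFamily g n →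
      AlgebraicGeometry.Smooth V.hom →
      ∀ (𝒲 : Scheme) (ι : 𝒲 ⟶ 𝒳.left), IsClosedImmersion ι → Flat (ι ≫ g.left) →
      ∀ (v₀ : ComplexPoints V), AlgebraicGeometry.IsIntegral (pullback ι (fiberι g v₀).left) →
      (∀ z : ↥(pullback ι (fiberι g v₀).left),
        (p : ℕ∞) ≤ Order.coheight ((pullback.snd ι (fiberι g v₀).left).base z)) →
      (∃ z : ↥(pullback ι (fiberι g v₀).left),
        Order.coheight ((pullback.snd ι (fiberι g v₀).left).base z) = (p : ℕ∞)) →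
      ∀ y ∈ classesSupportedOn (fiberOver g v₀) (Set.range (pullback.snd ι (fiberι g v₀).left).base) (2 * p),
      ∃ (Γ : complexBetti 𝒳 (2 * p)) (U₁ : Set V.left), IsOpen U₁ ∧ v₀.pt ∈ U₁ ∧
        (∀ t : ComplexPoints V, t.pt ∈ U₁ →
          complexBetti.map (fiberι g t) (2 * p) Γ ∈ algebraicClasses (fiberOver g t) p) ∧
        complexBetti.map (fiberι g v₀) (2 * p) Γ = y)
    {𝒳 S : SchemeOver ℂ} (f : 𝒳 ⟶ S) (n p : ℕ) (hf : IsSmoothProjectiveFamily f n)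
    (hproj : ∃ (N : ℕ) (ε : 𝒳 ⟶ projectiveSpace N ℂ ⊗ S), IsClosedImmersion ε.left ∧
      ε ≫ CartesianMonoidalCategory.snd (projectiveSpace N ℂ) S = f)
    (hS : AlgebraicGeometry.Smooth S.hom)
    (s₀ : ComplexPoints S) (Z₀ : Scheme) (i₀ : Z₀ ⟶ (fiberOver f s₀).left)
    (hi₀ : IsClosedImmersion i₀) (hlci : IsFiniteLocallyFree (conormalSheaf i₀))
    (hint : AlgebraicGeometry.IsIntegral Z₀)
    (hcoh : ∀ z : Z₀, (p : ℕ∞) ≤ Order.coheight (i₀.base z))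
    (hcohp : ∃ z : Z₀, Order.coheight (i₀.base z) = (p : ℕ∞))
    (hsr : IsBlochSemiregular i₀ n p)
    (W : complexBetti 𝒳 (2 * p))
    (hW : ∀ s : ComplexPoints S,
      IsOfHodgeType n (fiberOver f s) (2 * p) p p (complexBetti.map (fiberι f s) (2 * p) W))
    (hsupp : complexBetti.map (fiberι f s₀) (2 * p) W ∈
      classesSupportedOn (fiberOver f s₀) (Set.range i₀.base) (2 * p)) :
    ∃ U : Set (ComplexPoints S), IsOpen U ∧ s₀ ∈ U ∧
      ∀ t ∈ U, complexBetti.map (fiberι f t) (2 * p) W ∈ algebraicClasses (fiberOver f t) p := by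
  haveI := hS
  haveI := hi₀
  haveI := hint
  -- codimension `0`: every class is algebraic
  rcases Nat.eq_zero_or_pos p with rfl | hp
  · exact ⟨Set.univ, isOpen_univ, Set.mem_univ _, fun t _ => by
      rw [algebraicClasses_zero]; trivial⟩
  -- `W|_{X₀} = 0`: rigidity of the flat section near `s₀`
  by_cases h0 : complexBetti.map (fiberι f s₀) (2 * p) W = 0
  · obtain ⟨U, hU, hs₀U, hrig⟩ := exists_isOpen_forall_map_fiberι_eq_zero f hf s₀
    refine ⟨{t | t.pt ∈ U}, AlgPoints.isOpen_setOf_pt_mem (X := S) (L := ℂ) ⟨U, hU⟩, hs₀U,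
      fun t ht => ?_⟩
    rw [hrig (2 * p) W h0 t ht]
    exact Submodule.zero_mem _
  -- the generic point `η` of the integral `Z₀` has codimension exactly `p` in `X₀` …
  haveI : IrreducibleSpace Z₀ := inferInstance
  set η : Z₀ := genericPoint Z₀ with hηdef
  have hη : Order.coheight (i₀.base η) = (p : ℕ∞) := by
    obtain ⟨z₁, hz₁⟩ := hcohp
    refine le_antisymm ?_ (hcoh η)
    rw [← hz₁]
    exact Order.coheight_anti (Scheme.le_iff_specializes.2
      ((genericPoint_specializes z₁).map i₀.continuous))
  -- … and every point of codimension `p` of `Z₀` has closure `⊇ Z₀` in `X₀` (it is `η`)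
  have hgen : ∀ z : Z₀, Order.coheight (i₀.base z) = (p : ℕ∞) →
      Set.range i₀.base ⊆ closure {i₀.base z} := by
    intro z hz
    have hle : i₀.base z ≤ i₀.base η :=
      Scheme.le_iff_specializes.2 ((genericPoint_specializes z).map i₀.continuous)
    have hsp : i₀.base z ⤳ i₀.base η := by
      by_contra hne
      have hlt : i₀.base z < i₀.base η :=
        lt_of_le_not_ge hle (fun h => hne (Scheme.le_iff_specializes.1 h))
      have := Order.coheight_strictAnti hlt (by rw [hη]; exact ENat.coe_lt_top p)
      rw [hη, hz] at this
      exact lt_irrefl _ this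
    have hcl : closure {i₀.base η} = Set.range i₀.base := by
      rw [← Set.image_singleton, i₀.isClosedEmbedding.closure_image_eq, hηdef,
        genericPoint_closure, Set.image_univ]
    rw [← hcl]
    exact specializes_iff_closure_subset.1 hsp
  -- Bloch: the semiregular lci `Z₀` lifts to a flat family over a smooth `π : V ⟶ S` through `s₀`
  have hpure : ∀ z : Z₀, ∃ z' : Z₀, Order.coheight (i₀.base z') = (p : ℕ∞) ∧ i₀.base z' ⤳ i₀.base z :=
    fun z => ⟨η, hη, (genericPoint_specializes z).map i₀.continuous⟩
  have hclass : ∀ z : Z₀, Order.coheight (i₀.base z) = (p : ℕ∞) →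
      SupportClassStaysHodge f n p s₀ (closure {i₀.base z}) :=
    fun z hz => (SupportClassStaysHodge.intro W hW hsupp h0).mono (hgen z hz)
  obtain ⟨V, π, hπ, v₀, hv₀, 𝒵, ι, hι, hflat, e, he⟩ :=
    hB.of_smooth f n p hf hproj hS s₀ Z₀ i₀ hi₀ hlci hpure hclass hsr
  subst hv₀
  haveI := hπ
  haveI := hι
  haveI := hflat
  haveI : AlgebraicGeometry.Smooth V.hom := by rw [← Over.w π]; infer_instance
  have hg : IsSmoothProjectiveFamily (familyPullback.snd f π) n := hf.familyPullback_snd π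
  -- `θ : X₀' ≅ X₀`, the fibre of the base change over `v₀` and the fibre of `f` over `π v₀`
  set θ := fiberOverFamilyPullbackIso f π v₀ with hθdef
  have hih : ∀ x, θ.inv.left.base (θ.hom.left.base x) = x := fun x => by
    rw [← Scheme.Hom.comp_apply, ← Over.comp_left, θ.hom_inv_id]; rfl
  -- the transported set `W₀' = θ⁻¹(Z₀)` on `X₀'`
  set W₀' : Set (fiberOver (familyPullback.snd f π) v₀).left := θ.hom.left.base ⁻¹' Set.range i₀.base
    with hW₀'
  -- the central fibre of the flat family is `W₀'`
  have hsnd : pullback.snd ι (fiberι (familyPullback.snd f π) v₀).left ≫ θ.hom.left = e.hom ≫ i₀ := by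
    haveI : Subsingleton ↥((specOver ℂ ℂ).left) := inferInstanceAs (Subsingleton (PrimeSpectrum ℂ))
    haveI : IsClosedImmersion (AlgPoints.map π v₀).left :=
      isClosedImmersion_of_comp_eq_id _ _ (ComplexPoints.toSpecHom_comp_hom (AlgPoints.map π v₀))
    haveI : Mono (fiberι f (AlgPoints.map π v₀)).left := by
      change Mono (pullback.fst f.left (AlgPoints.map π v₀).left); infer_instance
    rw [← cancel_mono (fiberι f (AlgPoints.map π v₀)).left, Category.assoc, Category.assoc,
      ← Over.comp_left, hθdef, fiberOverFamilyPullbackIso_hom_fiberι, Over.comp_left,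
      ← Category.assoc, ← pullback.condition, Category.assoc]
    exact he
  have hrange : Set.range (pullback.snd ι (fiberι (familyPullback.snd f π) v₀).left).base = W₀' := by
    have key : ∀ z, θ.hom.left.base ((pullback.snd ι (fiberι (familyPullback.snd f π) v₀).left).base z) =
        i₀.base (e.hom.base z) := fun z => by
      rw [← Scheme.Hom.comp_apply, hsnd, Scheme.Hom.comp_apply]
    ext x
    constructor
    · rintro ⟨z, rfl⟩
      exact ⟨e.hom.base z, (key z).symm⟩
    · rintro ⟨z₀, hz₀⟩
      obtain ⟨z, rfl⟩ := e.hom.surjective z₀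
      exact ⟨z, by rw [← hih ((pullback.snd ι (fiberι (familyPullback.snd f π) v₀).left).base z),
          key, hz₀, hih]⟩
  have hcoh' : ∀ z ∈ W₀', (p : ℕ∞) ≤ Order.coheight z := by
    intro z hz
    obtain ⟨w, hw⟩ := hz
    rw [← coheight_left_base_eq_of_iso θ z, ← hw]
    exact hcoh w
  -- the scheme-theoretic central fibre `𝒵_{v₀} ≅ Z₀` is integral, of codimension exactly `p` in `X₀'`
  haveI : Nonempty ↥(pullback ι (fiberι (familyPullback.snd f π) v₀).left) := ⟨e.inv.base η⟩
  have hintP : AlgebraicGeometry.IsIntegral (pullback ι (fiberι (familyPullback.snd f π) v₀).left) :=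
    isIntegral_of_isOpenImmersion e.hom
  have hcohP : ∀ z : ↥(pullback ι (fiberι (familyPullback.snd f π) v₀).left),
      (p : ℕ∞) ≤ Order.coheight ((pullback.snd ι (fiberι (familyPullback.snd f π) v₀).left).base z) :=
    fun z => hcoh' _ (hrange ▸ ⟨z, rfl⟩)
  have hcohP2 : ∃ z : ↥(pullback ι (fiberι (familyPullback.snd f π) v₀).left),
      Order.coheight ((pullback.snd ι (fiberι (familyPullback.snd f π) v₀).left).base z) = (p : ℕ∞) := by
    refine ⟨e.inv.base η, ?_⟩
    have key : θ.hom.left.base ((pullback.snd ι (fiberι (familyPullback.snd f π) v₀).left).base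
        (e.inv.base η)) = i₀.base η := by
      rw [← Scheme.Hom.comp_apply (pullback.snd ι _) θ.hom.left, hsnd, Scheme.Hom.comp_apply,
        ← Scheme.Hom.comp_apply e.inv e.hom, e.inv_hom_id]
      rfl
    rw [← coheight_left_base_eq_of_iso θ, key, hη]
  -- the class to lift: `y := θ^*(W|_{X₀})`, supported on `W₀' = θ⁻¹(Z₀)` = image of `𝒵_{v₀}`
  set x₀ := complexBetti.map (fiberι f (AlgPoints.map π v₀)) (2 * p) W with hx₀def
  have hx₀' : complexBetti.map θ.hom (2 * p) x₀ ∈ classesSupportedOn _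
      (Set.range (pullback.snd ι (fiberι (familyPullback.snd f π) v₀).left).base) (2 * p) := by
    rw [hrange]
    exact mem_classesSupportedOn_iff.2
      (complexBetti.restrictCompl_map_eq_zero θ.hom (mem_classesSupportedOn_iff.1 hsupp))
  -- the lifted class (hypothesis `(LC′)`)
  obtain ⟨Γ, U₁, hU₁, hv₀U₁, hΓ, hΓy⟩ :=
    hLC (p := p) (familyPullback.snd f π) hp hg ‹_› 𝒵 ι hι hflat v₀ hintP hcohP hcohP2 _ hx₀'
  -- the global class `Θ := pr^* W - Γ` on `𝒳 ×_S V` vanishes on `X₀'`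
  set Θ : complexBetti (familyPullback f π) (2 * p) :=
    complexBetti.map (familyPullback.fst f π) (2 * p) W - Γ with hΘ
  have hΘ0 : complexBetti.map (fiberι (familyPullback.snd f π) v₀) (2 * p) Θ = 0 := by
    rw [hΘ, map_sub, map_fiberι_familyPullback, ← hθdef, ← hx₀def, hΓy, sub_self]
  -- rigidity over a Zariski neighbourhood `U` of `v₀`: there `pr^* W|_{X_{t'}} = Γ|_{X_{t'}}`
  obtain ⟨U, hU, hv₀U, hrig⟩ := exists_isOpen_forall_map_fiberι_eq_zero (familyPullback.snd f π) hg v₀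
  have halg : ∀ t' : ComplexPoints V, t'.pt ∈ U ∩ U₁ →
      complexBetti.map (fiberι f (AlgPoints.map π t')) (2 * p) W ∈
        algebraicClasses (fiberOver f (AlgPoints.map π t')) p := by
    intro t' ht'
    rw [← map_fiberι_familyPullback_mem_algebraicClasses_iff f π hf W t']
    have hM := hrig (2 * p) Θ hΘ0 t' ht'.1
    rw [hΘ, map_sub, sub_eq_zero] at hM
    rw [hM]
    exact hΓ t' ht'.2
  -- the image `π(U ∩ U₁)` is a Zariski neighbourhood of `pt s₀`, and complex points over it lift
  haveI : LocallyOfFiniteType S.hom := inferInstance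
  haveI : LocallyOfFiniteType π.left := inferInstance
  have hπU : IsOpen ((π.left : V.left → S.left) '' (U ∩ U₁)) := π.left.isOpenMap _ (hU.inter hU₁)
  refine ⟨{t | t.pt ∈ (π.left : V.left → S.left) '' (U ∩ U₁)},
    AlgPoints.isOpen_setOf_pt_mem (X := S) (L := ℂ) ⟨_, hπU⟩, ⟨v₀.pt, ⟨hv₀U, hv₀U₁⟩, rfl⟩,
    fun t ht => ?_⟩
  obtain ⟨t', ht'U, rfl⟩ := exists_complexPoints_map_eq_of_pt_mem_image π (hU.inter hU₁) t ht
  exact halg t' ht'U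

end Summit.HodgeConjecture.HodgeConjecture.Theorems

end
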